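/- LEAD seat `ym-line-cbag-p1` (prover-ym-line-cbag-p1-g24-0), route `EguchiKawaiDirectionLadder` (ideator ym-idea-2, LINE 8),
crux K_A `TripleSmallBallMargin` (stmt-QuantumFields-27724), S10-C ingredients (LEAD's assembly contract): the DETERMINISTIC
consequences of the triple small-ball event `S_R(D, X̃, Ỹ) ≤ t` for a diagonal first link `D = diag(d)` and block-absorbed links
`X̃ = X·ι(V)`, `Ỹ = Y·ι(V′)` — the inputs `h_off` (off-block Frobenius masses `≤ 2Nt/γ`, invariant under the absorbed block unitaries),
`h_block` (every diagonal block of the commutator has Frobenius² `≤ 2Nt`) and `h_rig` (within-block entrywise rigidity of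
`X_cc·V_c` against the block phases at budget `2Nt`) of width seat w4's decoupling capstone.  ROUTE-INDEPENDENT.  Nothing here bears
on the Yang–Mills mass gap (barrier-ledger line onto `EguchiKawaiBreakdown`). -/
import Summits.QuantumFields.YangMills.Theorems.EguchiKawaiDirectionLadderFreeTripleOfRigidity
import Summits.QuantumFields.YangMills.Theorems.EguchiKawaiDirectionLadderBlockPairLaw
import Summits.QuantumFields.YangMills.Theorems.EguchiKawaiDirectionLadderBlockPairAlgebra
import HarnessLib

/-!
# Route `EguchiKawaiDirectionLadder`, crux `TripleSmallBallMargin`: consequences of the triple event in the first-link fibre (S10-C)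

For `D, X̃, Ỹ ∈ U(N)` with `(D : Matrix) = diag(d)`:
* `pair_frobSq_le_of_ekAction_three_le` — `S_R(D,X̃,Ỹ) ≤ t ⇒ ‖DX̃ − X̃D‖_F², ‖DỸ − ỸD‖_F², ‖X̃Ỹ − ỸX̃‖_F² ≤ 2Nt` (`N ≥ 1`);
* `weighted_toBlock_le_frobSq_comm` — `Σ_{i,j ∈ p×q} |d_i − d_j|²|X̃_{ij}|² ≤ ‖DX̃ − X̃D‖_F²`;
* `offBlock_mass_le` — for `γ`-separated blocks `a ≠ b`: `γ·Σ|X̃.toBlock a b|² ≤ ‖DX̃ − X̃D‖_F²`;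
* `offBlock_mass_mul_blockDiag`, `withinBlock_mul_blockDiag` — `X̃ = X·ι_ℓ(V)`: off-block masses of `X̃` and `X` agree, and
  `X̃.toBlock c c = X.toBlock c c · V_c`.
-/

set_option autoImplicit false

noncomputable section

open MeasureTheory
open scoped Matrix ENNReal
open Literature.Barriers.QuantumFields

namespace Summit.QuantumFields.YangMills.Theorems.EguchiKawaiDirectionLadder

variable {N m : ℕ}

/-- **The three pair constraints.**  `S_R(D, X̃, Ỹ) ≤ t` forces each of the three commutators to have `‖·‖_F² ≤ 2Nt` (`N ≥ 1`). -/
theorem pair_frobSq_le_of_ekAction_three_le (hN : 0 < N) (D X Y : UN N) {t : ℝ}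
    (h : ekAction (![D, X, Y] : EKConfig 3 N) ≤ t) :
    frobSq ((D : Matrix (Fin N) (Fin N) ℂ) * (X : Matrix (Fin N) (Fin N) ℂ) -
        (X : Matrix (Fin N) (Fin N) ℂ) * (D : Matrix (Fin N) (Fin N) ℂ)) ≤ 2 * N * t ∧
    frobSq ((D : Matrix (Fin N) (Fin N) ℂ) * (Y : Matrix (Fin N) (Fin N) ℂ) -
        (Y : Matrix (Fin N) (Fin N) ℂ) * (D : Matrix (Fin N) (Fin N) ℂ)) ≤ 2 * N * t ∧
    frobSq ((X : Matrix (Fin N) (Fin N) ℂ) * (Y : Matrix (Fin N) (Fin N) ℂ) -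
        (Y : Matrix (Fin N) (Fin N) ℂ) * (X : Matrix (Fin N) (Fin N) ℂ)) ≤ 2 * N * t := by
  have h3 := ekAction_three_eq (![D, X, Y] : EKConfig 3 N)
  simp only [Matrix.cons_val_zero, Matrix.cons_val_one, Matrix.cons_val] at h3
  have hDX := ekAction_nonneg (![D, X] : EKConfig 2 N)
  have hDY := ekAction_nonneg (![D, Y] : EKConfig 2 N)
  have hXY := ekAction_nonneg (![X, Y] : EKConfig 2 N)
  have e1 := ekAction_pair_eq_frobSq hN D X
  have e2 := ekAction_pair_eq_frobSq hN D Y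
  have e3 := ekAction_pair_eq_frobSq hN X Y
  have hN' : (0 : ℝ) < 2 * N := by positivity
  have k1 : ekAction (![D, X] : EKConfig 2 N) ≤ t := by rw [h3] at h; linarith
  have k2 : ekAction (![D, Y] : EKConfig 2 N) ≤ t := by rw [h3] at h; linarith
  have k3 : ekAction (![X, Y] : EKConfig 2 N) ≤ t := by rw [h3] at h; linarith
  rw [e1, div_le_iff₀ hN'] at k1
  rw [e2, div_le_iff₀ hN'] at k2
  rw [e3, div_le_iff₀ hN'] at k3
  exact ⟨by linarith, by linarith, by linarith⟩

/-- The entries of `DX − XD` on a block: `((DX − XD).toBlock p q) i j = (d_i − d_j) X_{ij}`. -/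
theorem toBlock_diagonal_comm_apply (d : Fin N → ℂ) (X : Matrix (Fin N) (Fin N) ℂ) (p q : Fin N → Prop)
    (i : {i // p i}) (j : {j // q j}) :
    (Matrix.diagonal d * X - X * Matrix.diagonal d).toBlock p q i j = (d i - d j) * X i j := by
  rw [Matrix.toBlock_apply, Matrix.sub_apply, Matrix.diagonal_mul, Matrix.mul_diagonal]
  ring

/-- **Within a block the rigidity weight is an exact sub-sum**: `Σ_{i∈p, j∈q} |d_i − d_j|²|X_{ij}|² ≤ ‖DX − XD‖_F²`. -/
theorem weighted_toBlock_le_frobSq_comm (d : Fin N → ℂ) (X : Matrix (Fin N) (Fin N) ℂ) (p q : Fin N → Prop)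
    [DecidablePred p] [DecidablePred q] :
    ∑ i : {i // p i}, ∑ j : {j // q j}, ‖d i - d j‖ ^ 2 * ‖X.toBlock p q i j‖ ^ 2 ≤
      frobSq (Matrix.diagonal d * X - X * Matrix.diagonal d) := by
  have h := sum_norm_sq_toBlock_le_frobSq (Matrix.diagonal d * X - X * Matrix.diagonal d) p q
  refine le_trans (le_of_eq ?_) h
  refine Finset.sum_congr rfl fun i _ => Finset.sum_congr rfl fun j _ => ?_
  rw [toBlock_diagonal_comm_apply, norm_mul, mul_pow, Matrix.toBlock_apply]

/-- **Off-block mass**: if `γ ≤ |d_i − d_j|²` for `i ∈ p`, `j ∈ q`, then `γ · Σ|X.toBlock p q|² ≤ ‖DX − XD‖_F²`. -/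
theorem offBlock_mass_le (d : Fin N → ℂ) (X : Matrix (Fin N) (Fin N) ℂ) (p q : Fin N → Prop)
    [DecidablePred p] [DecidablePred q] {γ : ℝ} (hsep : ∀ i j, p i → q j → γ ≤ ‖d i - d j‖ ^ 2) :
    γ * ∑ i : {i // p i}, ∑ j : {j // q j}, ‖X.toBlock p q i j‖ ^ 2 ≤ frobSq (Matrix.diagonal d * X - X * Matrix.diagonal d) := by
  refine le_trans ?_ (weighted_toBlock_le_frobSq_comm d X p q)
  rw [Finset.mul_sum]
  refine Finset.sum_le_sum fun i _ => ?_
  rw [Finset.mul_sum]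
  refine Finset.sum_le_sum fun j _ => ?_
  exact mul_le_mul_of_nonneg_right (hsep i j i.2 j.2) (by positivity)

/-- Off-block (column block `a`) masses are unchanged by right multiplication with `ι_ℓ(V)`. -/
theorem offBlock_mass_mul_blockDiag (ℓ : Fin N → Fin m) (X : UN N) (V : BlockUnitaries ℓ) (p : Fin N → Prop)
    [DecidablePred p] (a : Fin m) :
    ∑ i : {i // p i}, ∑ j : {j // ℓ j = a},
        ‖((X * blockDiagUnitary ℓ V : UN N) : Matrix (Fin N) (Fin N) ℂ).toBlock p (fun i => ℓ i = a) i j‖ ^ 2 =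
      ∑ i : {i // p i}, ∑ j : {j // ℓ j = a}, ‖(X : Matrix (Fin N) (Fin N) ℂ).toBlock p (fun i => ℓ i = a) i j‖ ^ 2 := by
  rw [Matrix.UnitaryGroup.mul_val, coe_blockDiagUnitary, sum_norm_sq_toBlock_mul_blockDiag]

/-- The diagonal block of `X · ι_ℓ(V)` is `X_cc · V_c`. -/
theorem withinBlock_mul_blockDiag (ℓ : Fin N → Fin m) (X : UN N) (V : BlockUnitaries ℓ) (c : Fin m) :
    ((X * blockDiagUnitary ℓ V : UN N) : Matrix (Fin N) (Fin N) ℂ).toBlock (fun i => ℓ i = c) (fun i => ℓ i = c) =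
      (X : Matrix (Fin N) (Fin N) ℂ).toBlock (fun i => ℓ i = c) (fun i => ℓ i = c) *
        (V c : Matrix {i : Fin N // ℓ i = c} {i : Fin N // ℓ i = c} ℂ) :=
  toBlock_coe_mul_blockDiagUnitary ℓ X V _ c

/-- **`h_rig` provider**: on the triple event, the absorbed diagonal block `X_cc · V_c` is entrywise rigid against the block phases at
budget `‖D X̃ − X̃ D‖_F²` (`X̃ = X · ι_ℓ(V)`). -/
theorem withinBlock_rigidity_le (ℓ : Fin N → Fin m) (d : Fin N → ℂ) (X : UN N) (V : BlockUnitaries ℓ) (c : Fin m) :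
    ∑ i : {i // ℓ i = c}, ∑ j : {j // ℓ j = c}, ‖d i - d j‖ ^ 2 *
        ‖((X : Matrix (Fin N) (Fin N) ℂ).toBlock (fun i => ℓ i = c) (fun i => ℓ i = c) *
          (V c : Matrix {i : Fin N // ℓ i = c} {i : Fin N // ℓ i = c} ℂ)) i j‖ ^ 2 ≤
      frobSq (Matrix.diagonal d * ((X * blockDiagUnitary ℓ V : UN N) : Matrix (Fin N) (Fin N) ℂ) -
        ((X * blockDiagUnitary ℓ V : UN N) : Matrix (Fin N) (Fin N) ℂ) * Matrix.diagonal d) := by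
  rw [← withinBlock_mul_blockDiag]
  exact weighted_toBlock_le_frobSq_comm d _ (fun i => ℓ i = c) (fun i => ℓ i = c)

/-- **`h_block` provider**: every diagonal block of the commutator has Frobenius² at most the whole: `Σ|([X̃,Ỹ]).toBlock c c|² ≤ ‖X̃Ỹ − ỸX̃‖_F²`. -/
theorem commutatorBlock_le (X Y : Matrix (Fin N) (Fin N) ℂ) (p : Fin N → Prop) [DecidablePred p] :
    ∑ i : {i // p i}, ∑ j : {j // p j}, ‖(X * Y - Y * X).toBlock p p i j‖ ^ 2 ≤ frobSq (X * Y - Y * X) :=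
  sum_norm_sq_toBlock_le_frobSq _ p p

end Summit.QuantumFields.YangMills.Theorems.EguchiKawaiDirectionLadder

end
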